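import Summits.QuantumFields.BalabanUV.Beta.GAN24.AveragedPropagatorLocality

/-!
# G-an2-4 ∕ (CONV-C), road P2, route R2-S1, VECTOR LAYER, PART 8b — THE DEFECT FIELDS OF PART 4 IN THE KERNEL CURRENCY: `PhiL`, `PsiF`, `phiF`,
# `phiLdiv` decay from the source site like the derivative fields `∇u`, `∇∇u` they are built from (constants `ρ`, `ρe^{δ}`, `ρe^{δ}`, `ρ(d+1)e^{δ}`)

Unit `b2b-balaban-gan24-p2` (gen 30), BINDER row G-an2-4 ∕ (CONV-C), road P2; crux team (2).  Companion of `AveragedPropagatorLocality` (split for the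
400-line rule): the four defect fields of `AveragedPropagatorDefectFields` read `∇_νu`, `∇_νᴴ∇_νu`, `∇_νᴴu_ν`, `∇_μ∇_νᴴu` at `par x′`; the `ᴴ`-variants
are the plain differences read one fine site back (`fdiffH_apply_eq_neg_fdiff`, `fdiff_fdiffH_comm`), which costs `e^{δ}` in the decay constant
(`fieldDecay_shift_sub`) — so ONLY the plain letters `∇𝒢`, `∇∇𝒢` of the swarm's `VectorRowDecayLetters` are needed downstream:
 * `fieldDecay_PhiL` (`[ρ·B]`), `fieldDecay_PsiF` (`[ρ·e^{δ}·B]`), `fieldDecay_phiF` (`[ρ·e^{δ}·B]`), `sdiff_divS_apply`, `fieldDecay_phiLdiv`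
   (`[ρ·(d+1)·e^{δ}·B]`), `ρ = (R−1)∕(RN)`.
HONEST SCOPE.  Finite-lattice bookkeeping at `U = 1`; [folklore], kernel-checked, no `sorry`, 0 def.  NOT (CONV-C), NEVER «G-an2-4 closed», NOT NE2, NOT
D1, NOT BetaPertH, NOT continuum, NOT Clay; not in print — our bookkeeping.  HONEST DEPENDENCY: continuum YM on T⁴ ⇐ BetaPertH ∧ nine spine estimates
(0/9 proved); BetaPertH ⇐ (D1) ∧ (D4) ∧ CAP+tail; G-an2-4 gates asym, D1 and NE2/3/4.
-/

noncomputable section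

open scoped BigOperators ComplexConjugate Matrix

namespace Summit.QuantumFields.BalabanUV.Beta.GAN24.AveragedPropagatorDefectDecay

open Literature.MathematicalPhysics.QuantumFieldTheory.Balaban1983to89
open B5Prop11Plancherel (Tor fine fdiff)
open B5Block118 (tstep bpt)
open B5Blocks16 (blockOf blockOf_bpt)
open B6LowerBound2153Torus (rep)
open B4TorusKernel.MultiPeriod (torusSupNorm)
open Summit.QuantumFields.BalabanUV.T4Continuum.BalabanAveragedTowerModes (par)
open Summit.QuantumFields.BalabanUV.Beta.GAN24.StaircaseLaplacianDefect (stair stair_mulVec piL piF norm_piL_le norm_piF_le)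
open Summit.QuantumFields.BalabanUV.Beta.GAN24.StaircaseAveragingDefect (ratio_nonneg)
open Summit.QuantumFields.BalabanUV.Beta.GAN24.BlockFieldDecay (FieldDecay)
open Summit.QuantumFields.BalabanUV.Beta.GAN24.AveragedPropagatorDefectFields
open Summit.QuantumFields.BalabanUV.Beta.GAN24.AveragedPropagatorLocality (fieldDecay_shift_sub fieldDecay_parV fieldDecay_par)

variable {d : ℕ}

/-! ## §3 The defect fields of Part 4 from decaying derivative fields -/

section DefectFields

variable (N R : ℕ) [NeZero N] [NeZero R] (M : Fin (d + 1) → ℕ) [hM : ∀ μ, NeZero (M μ)]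

/-- `PhiL ν u` decays like `∇_νu`, constant `ρ·B`. [folklore] -/
theorem fieldDecay_PhiL (ν : Fin (d + 1)) {u : Tor (fine N M) × Fin (d + 1) → ℂ} {B δ : ℝ} {y' : Tor M}
    (h : FieldDecay M (fun i : Tor (fine N M) × Fin (d + 1) => blockOf N M i.1) (fdiff (fine N M) (N : ℂ) ν *ᵥ u) B δ y') :
    FieldDecay M (fun i : Tor (fine (R * N) M) × Fin (d + 1) => blockOf (R * N) M i.1) (PhiL N R M ν u)
      ((((R : ℝ) - 1) / ((R : ℝ) * N)) * B) δ y' :=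
  (fieldDecay_parV N R M h).mul_left (fun i => piL N R M ν i.1) (fun i => norm_piL_le N R M ν i.1)

/-- `PsiF ν u` decays like `∇_ν∇_νu`, constant `ρ·e^{δ}·B` (`∇ᴴ∇ = −τ₋∇∇`). [folklore] -/
theorem fieldDecay_PsiF (ν : Fin (d + 1)) {u : Tor (fine N M) × Fin (d + 1) → ℂ} {B δ : ℝ} {y' : Tor M} (hB : 0 ≤ B) (hδ : 0 ≤ δ)
    (h : FieldDecay M (fun i : Tor (fine N M) × Fin (d + 1) => blockOf N M i.1)
      (fdiff (fine N M) (N : ℂ) ν *ᵥ (fdiff (fine N M) (N : ℂ) ν *ᵥ u)) B δ y') :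
    FieldDecay M (fun i : Tor (fine (R * N) M) × Fin (d + 1) => blockOf (R * N) M i.1) (PsiF N R M ν u)
      ((((R : ℝ) - 1) / ((R : ℝ) * N)) * (Real.exp δ * B)) δ y' := by
  -- `∇ᴴ(∇u)` is `−(∇∇u)` read one site back
  have hH : FieldDecay M (fun i : Tor (fine N M) × Fin (d + 1) => blockOf N M i.1)
      ((fdiff (fine N M) (N : ℂ) ν)ᴴ *ᵥ (fdiff (fine N M) (N : ℂ) ν *ᵥ u)) (Real.exp δ * B) δ y' := by
    intro i
    obtain ⟨x, κ⟩ := i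
    have hs := fieldDecay_shift_sub N M hB hδ h ν (x, κ)
    dsimp only at hs ⊢
    rw [fdiffH_apply_eq_neg_fdiff, norm_neg]
    exact hs
  exact (fieldDecay_parV N R M hH).mul_left (fun i => piF N R M ν i.1) (fun i => norm_piF_le N R M ν i.1)

/-- `phiF ν u` (scalar) decays like `∇_νu`, constant `ρ·e^{δ}·B`. [folklore] -/
theorem fieldDecay_phiF (ν : Fin (d + 1)) {u : Tor (fine N M) × Fin (d + 1) → ℂ} {B δ : ℝ} {y' : Tor M} (hB : 0 ≤ B) (hδ : 0 ≤ δ)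
    (h : FieldDecay M (fun i : Tor (fine N M) × Fin (d + 1) => blockOf N M i.1) (fdiff (fine N M) (N : ℂ) ν *ᵥ u) B δ y') :
    FieldDecay M (blockOf (R * N) M) (phiF N R M ν u) ((((R : ℝ) - 1) / ((R : ℝ) * N)) * (Real.exp δ * B)) δ y' := by
  have hH : FieldDecay M (fun i : Tor (fine N M) × Fin (d + 1) => blockOf N M i.1)
      ((fdiff (fine N M) (N : ℂ) ν)ᴴ *ᵥ u) (Real.exp δ * B) δ y' := by
    intro i
    obtain ⟨x, κ⟩ := i
    have hs := fieldDecay_shift_sub N M hB hδ h ν (x, κ)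
    dsimp only at hs ⊢
    rw [fdiffH_apply_eq_neg_fdiff, norm_neg]
    exact hs
  intro z
  unfold phiF
  rw [norm_mul, stair_mulVec]
  have e : ((B5Action121.sdiff (fine N M) (N : ℂ) ν)ᴴ *ᵥ B5Action121.comp (fine N M) u ν) (par N R M z)
      = ((fdiff (fine N M) (N : ℂ) ν)ᴴ *ᵥ u) (par N R M z, ν) := by
    rw [StaircaseLaplacianDefectVec.fdiffH_mulVec_slice]; rfl
  rw [e]
  have h1 := fieldDecay_par N R M ν hH z
  calc _ ≤ (((R : ℝ) - 1) / ((R : ℝ) * N)) * (Real.exp δ * B * Real.exp (-(δ * torusSupNorm M (rep M (blockOf (R * N) M z) - rep M y')))) :=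
        mul_le_mul (norm_piF_le N R M ν z) h1 (norm_nonneg _) (ratio_nonneg N R)
    _ = _ := by ring

/-- `∂_μ(∂ᴴu)(x) = Σ_ν (∇_μ∇_νᴴu)(x, ν)`. [folklore] -/
theorem sdiff_divS_apply (μ : Fin (d + 1)) (u : Tor (fine N M) × Fin (d + 1) → ℂ) (x : Tor (fine N M)) :
    (B5Action121.sdiff (fine N M) (N : ℂ) μ *ᵥ ((B5Action121.GradOp (fine N M) (N : ℂ))ᴴ *ᵥ u)) x
      = ∑ ν, (fdiff (fine N M) (N : ℂ) μ *ᵥ ((fdiff (fine N M) (N : ℂ) ν)ᴴ *ᵥ u)) (x, ν) := by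
  have hfun : (B5Action121.GradOp (fine N M) (N : ℂ))ᴴ *ᵥ u = ∑ ν, (B5Action121.sdiff (fine N M) (N : ℂ) ν)ᴴ *ᵥ B5Action121.comp (fine N M) u ν := by
    funext y; rw [B5Action121.GradOp_conjTranspose_mulVec, B5Action121.divS]
  rw [hfun, Matrix.mulVec_sum, Finset.sum_apply]
  refine Finset.sum_congr rfl fun ν _ => ?_
  rw [StaircaseLaplacianDefectVec.fdiff_mulVec_slice]
  congr 1
  funext y
  rw [StaircaseLaplacianDefectVec.fdiffH_mulVec_slice]
  rfl

/-- `phiLdiv μ u` (scalar) decays like `∇∇u`, constant `ρ·(d+1)·e^{δ}·B`. [folklore] -/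
theorem fieldDecay_phiLdiv (μ : Fin (d + 1)) {u : Tor (fine N M) × Fin (d + 1) → ℂ} {B δ : ℝ} {y' : Tor M} (hB : 0 ≤ B) (hδ : 0 ≤ δ)
    (h : ∀ μ' ν', FieldDecay M (fun i : Tor (fine N M) × Fin (d + 1) => blockOf N M i.1)
      (fdiff (fine N M) (N : ℂ) ν' *ᵥ (fdiff (fine N M) (N : ℂ) μ' *ᵥ u)) B δ y') :
    FieldDecay M (blockOf (R * N) M) (phiLdiv N R M μ u) ((((R : ℝ) - 1) / ((R : ℝ) * N)) * ((d + 1) * (Real.exp δ * B))) δ y' := by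
  -- each `∇_μ∇_νᴴu = ∇_νᴴ∇_μu = −τ₋(∇_ν∇_μu)` decays with constant `e^{δ}B`
  have hH : ∀ ν, FieldDecay M (fun i : Tor (fine N M) × Fin (d + 1) => blockOf N M i.1)
      (fdiff (fine N M) (N : ℂ) μ *ᵥ ((fdiff (fine N M) (N : ℂ) ν)ᴴ *ᵥ u)) (Real.exp δ * B) δ y' := by
    intro ν i
    obtain ⟨x, κ⟩ := i
    have hs := fieldDecay_shift_sub N M hB hδ (h μ ν) ν (x, κ)
    dsimp only at hs ⊢
    rw [fdiff_fdiffH_comm, fdiffH_apply_eq_neg_fdiff, norm_neg]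
    exact hs
  intro z
  unfold phiLdiv
  rw [norm_mul, stair_mulVec, sdiff_divS_apply]
  have hsum : ‖∑ ν, (fdiff (fine N M) (N : ℂ) μ *ᵥ ((fdiff (fine N M) (N : ℂ) ν)ᴴ *ᵥ u)) (par N R M z, ν)‖
      ≤ (d + 1) * (Real.exp δ * B * Real.exp (-(δ * torusSupNorm M (rep M (blockOf (R * N) M z) - rep M y')))) := by
    calc _ ≤ ∑ ν, ‖(fdiff (fine N M) (N : ℂ) μ *ᵥ ((fdiff (fine N M) (N : ℂ) ν)ᴴ *ᵥ u)) (par N R M z, ν)‖ := norm_sum_le _ _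
      _ ≤ ∑ ν : Fin (d + 1), Real.exp δ * B * Real.exp (-(δ * torusSupNorm M (rep M (blockOf (R * N) M z) - rep M y'))) :=
          Finset.sum_le_sum fun ν _ => fieldDecay_par N R M ν (hH ν) z
      _ = _ := by rw [Finset.sum_const, Finset.card_univ, Fintype.card_fin, nsmul_eq_mul]; push_cast; ring
  calc _ ≤ (((R : ℝ) - 1) / ((R : ℝ) * N)) * ((d + 1) * (Real.exp δ * B * Real.exp (-(δ * torusSupNorm M (rep M (blockOf (R * N) M z) - rep M y'))))) :=
        mul_le_mul (norm_piL_le N R M μ z) hsum (norm_nonneg _) (ratio_nonneg N R)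
    _ = _ := by ring

end DefectFields

end Summit.QuantumFields.BalabanUV.Beta.GAN24.AveragedPropagatorDefectDecay

end
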